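import Literature.AnabelianGeometry.SemiGraphs.TemperedAbsolutenessReductions

/-!
# [SemiAnbd] Cor. 6.10 (i), converse direction, and the assembled reductions of Cor. 6.10 / 6.11

Mochizuki, *Semi-graphs of anabelioids*, Publ. RIMS **42** (2006) [SemiAnbd], §6 pp. 77–78.  PROOF-ONLY
companion (abc-iut seat f-168, F fact-proving wave, tranche 168; rung LADDER-ABC:A2.C) of
`TemperedAbsoluteness.lean` (abc-iut-L3-t4, FROZEN) continuing `TemperedAbsolutenessReductions.lean`:
* Cor. 6.10 (i), direction "temp-absolute ⇒ absolute" (`isDiscretelyAbsoluteCusp_of_isDiscretelyTempAbsoluteCusp`,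
  `isIntegrallyAbsoluteCusp_of_…`): a profinite `α̂ : Π_{X_K} ⥲ Π_{Y_L}` lifts to a tempered `β` lying
  under it (Thm. 6.6, `TemperedCurve.ProfiniteOuterIsoLifts`, FACT-LIST F-1707 BY NAME); `β(D_x)` is a
  cuspidal decomposition group `γ′ D_{y′} γ′⁻¹` (Thm. 6.5 (iii), `TemperedCurve.IsoPreservesCuspidalDecomp`,
  F-1704 BY NAME); the tempered compatibility at `(β, y′, γ′)` is pushed to the completions by the transport
  lemmas of the first file (`α̂(D̂_x) = δ D̂_{y′} δ⁻¹`, `α̂(hatOf 𝒮_X) = δ · hatOf(γ′ 𝒮_{Y} γ′⁻¹)`,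
  `δ = c ι_Y(γ′)`); comparing with the hypothesis `α̂(D̂_x) = γ̂ D̂_y γ̂⁻¹` needs TWO interface laws of the
  profinite side ([Mzk8] = Mochizuki, *Galois sections in absolute anabelian geometry*, Thm. 1.3 (ii)/(iii),
  the profinite cuspidal decomposition groups are commensurably terminal and determine the cusp): the
  RIGIDITY LAW (`D̂_{y′}` conjugate to `D̂_y` for cusps `y, y′` ⇒ `y′ = y`) and the NORMALISER LAW (the set
  `hatOf` of the canonical structure at `y` is stable under every `ε ∈ Π_{Y_L}` normalising `D̂_y`) —
  both inlined as hypotheses, never asserted (`image_map_hatOf_eq_of_tempCompat` is the law-free engine).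
* The assembled statements: `absoluteIffTempAbsoluteCusp_of_laws` (Cor. 6.10 (i) as typed, per genuine
  datum), `temperedAbsolutenessHolds_of_laws` (**F-1656 ⟸ F-1707 + F-1704 + four interface laws**:
  goodness/transport, compactness, rigidity, normaliser) and `genusZeroTempAbsolutenessHolds_of_laws`
  (**F-1655 ⟸ the same + the absolute [Mzk8] Cor. 4.11**), i.e. the printed inference
  "we thus conclude [cf. Theorem 6.6]" (p. 77) and the proof of Cor. 6.11 (p. 78 l. 1–2) with every input
  named.
HONEST FRAMING: statements about OUR typed interface of a refereed prerequisite paper; the laws are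
properties the genuine data have in print which the typed records do not carry; nothing is asserted;
typed ≠ proved; a FACT-LIST row is an assumption label; no bearing on, and no side taken on, [IUTchIII]
Cor. 3.12. [cite: MochizukiSemiAnbd2006, Cor 6.10 p.77] [cite: MochizukiSemiAnbd2006, Cor 6.11 pp.77-78]
-/

noncomputable section

namespace Literature.AnabelianGeometry.SemiGraphs

open scoped Pointwise
open _root_.Topology

variable {p : ℕ} [Fact p.Prime]

/-! ### 1. The engine: from a tempered compatibility under `α̂` to the profinite one -/

namespace TemperedCurve

variable {X Y : TemperedCurve p}

/-- **Engine of Cor. 6.10 (i), "temp-absolute ⇒ absolute".**  Let `β` lie under `α̂` through `c`, let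
`β(D_x) = γ′ D_{y′} γ′⁻¹` with the tempered compatibility `β(𝒮_X) = γ′ 𝒮_Y(y′) γ′⁻¹`, and let
`α̂(D̂_x) = γ̂ D̂_y γ̂⁻¹`.  If conjugate profinite cuspidal decomposition groups have the same cusp (`hrig`)
and `hatOf 𝒮_Y(y)` is stable under the normaliser of `D̂_y` (`hnorm`), then
`α̂(hatOf 𝒮_X) = γ̂ · hatOf 𝒮_Y(y) · γ̂⁻¹`. [cite: MochizukiSemiAnbd2006, Cor 6.10(i) p.77] -/
theorem image_map_hatOf_eq_of_tempCompat (αhat : X.PiHat ≃ₜ* Y.PiHat) (β : X.PiTemp ≃ₜ* Y.PiTemp)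
    (c : Y.PiHat) (hc : ∀ g : X.PiTemp, αhat (X.toHat g) = c * Y.toHat (β g) * c⁻¹) (x : X.Pt)
    (𝒮X : Set (Subgroup X.PiTemp)) (𝒮Y : Y.Pt → Set (Subgroup Y.PiTemp)) {y y' : Y.Pt}
    (γhat : ConjAct Y.PiHat) (γ' : ConjAct Y.PiTemp)
    (hDhat : (X.decompHat x).map αhat.toMulEquiv.toMonoidHom = γhat • Y.decompHat y)
    (hD' : (X.decomp x).map β.toMulEquiv.toMonoidHom = γ' • Y.decomp y')
    (htemp : (fun S => S.map β.toMulEquiv.toMonoidHom) '' 𝒮X = (fun S => γ' • S) '' 𝒮Y y')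
    (hrig : (∃ g : ConjAct Y.PiHat, Y.decompHat y' = g • Y.decompHat y) → y' = y)
    (hnorm : ∀ ε : ConjAct Y.PiHat, ε • Y.decompHat y = Y.decompHat y →
      (fun S => ε • S) '' Y.hatOf (𝒮Y y) = Y.hatOf (𝒮Y y)) :
    (fun S => S.map αhat.toMulEquiv.toMonoidHom) '' X.hatOf 𝒮X =
      (fun S => γhat • S) '' Y.hatOf (𝒮Y y) := by
  set δ : ConjAct Y.PiHat := ConjAct.toConjAct (c * Y.toHat (ConjAct.ofConjAct γ')) with hδ
  have hD'hat : (X.decompHat x).map αhat.toMulEquiv.toMonoidHom = δ • Y.decompHat y' :=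
    map_decompHat_eq_of_liesUnder αhat β c hc x y' γ' hD'
  have hyy : y' = y := hrig ⟨δ⁻¹ * γhat, by rw [mul_smul, ← hDhat, hD'hat, inv_smul_smul]⟩
  rw [hyy] at hD'hat htemp
  have hε : (δ⁻¹ * γhat) • Y.decompHat y = Y.decompHat y := by
    rw [mul_smul, ← hDhat, hD'hat, inv_smul_smul]
  have hhat : (fun S => S.map αhat.toMulEquiv.toMonoidHom) '' X.hatOf 𝒮X =
      (fun S => δ • S) '' Y.hatOf (𝒮Y y) := by
    rw [image_map_hatOf_eq_of_liesUnder αhat β c hc, htemp, ← image_conj_hatOf_eq, Set.image_image]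
    refine Set.image_congr' fun S => ?_
    rw [smul_smul, ← map_mul]
  rw [hhat]
  have hn := hnorm (δ⁻¹ * γhat) hε
  conv_lhs => rw [← hn, Set.image_image]
  refine Set.image_congr' fun S => ?_
  rw [smul_smul, mul_inv_cancel_left]

end TemperedCurve

/-! ### 2. Cor. 6.10 (i), direction "temp-absolute ⇒ absolute" -/

namespace AbsolutenessOrigin

variable (Ω : AbsolutenessOrigin p)

/-- **Cor. 6.10 (i), discrete clause, direction "discretely temp-absolute ⇒ discretely absolute"** at a
cusp `x` of `X_K`, FROM Thm. 6.6 (`h66`) and Thm. 6.5 (iii) (`h65`) for the genuine pairs over `X_K`, and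
the two profinite-side laws of [Mzk8] Thm. 1.3 — RIGIDITY (`hrig`: conjugate `D̂`'s of cusps have the
same cusp) and NORMALISER (`hnorm`: `hatOf` of the canonical discrete structure at `y` is stable under
the normaliser of `D̂_y`) — for genuine data. [cite: MochizukiSemiAnbd2006, Cor 6.10(i) p.77] -/
theorem isDiscretelyAbsoluteCusp_of_isDiscretelyTempAbsoluteCusp {X : TemperedCurve p}
    (SX : CuspidalStructures X) {x : X.Pt} (hx : X.IsCusp x)
    (h66 : ∀ Y : TemperedCurve p, Ω.IsHyperbolicCurveOrigin Y → X.ProfiniteOuterIsoLifts Y)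
    (h65 : ∀ Y : TemperedCurve p, Ω.IsHyperbolicCurveOrigin Y → X.IsoPreservesCuspidalDecomp Y)
    (hrig : ∀ Y : TemperedCurve p, Ω.IsHyperbolicCurveOrigin Y → ∀ y y' : Y.Pt, Y.IsCusp y →
      Y.IsCusp y' → (∃ g : ConjAct Y.PiHat, Y.decompHat y' = g • Y.decompHat y) → y' = y)
    (hnorm : ∀ (Y : TemperedCurve p) (SY : CuspidalStructures Y), Ω.IsHyperbolicCurveOrigin Y →
      Ω.IsStructuresOrigin SY → ∀ y : Y.Pt, Y.IsCusp y → ∀ ε : ConjAct Y.PiHat,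
        ε • Y.decompHat y = Y.decompHat y →
          (fun S => ε • S) '' Y.hatOf (SY.canonicalDiscrete y) = Y.hatOf (SY.canonicalDiscrete y))
    (h : Ω.IsDiscretelyTempAbsoluteCusp SX x) : Ω.IsDiscretelyAbsoluteCusp SX x := by
  intro Y SY hY hSY αhat y γhat hy hDhat
  obtain ⟨⟨β, c, hc⟩, -⟩ := h66 Y hY αhat
  obtain ⟨y', hy', γ', hγ'⟩ := ((h65 Y hY) β (X.decomp x)).1 ⟨x, hx, 1, (one_smul _ _).symm⟩
  exact TemperedCurve.image_map_hatOf_eq_of_tempCompat αhat β c hc x (SX.canonicalDiscrete x)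
    (fun z => SY.canonicalDiscrete z) γhat γ' hDhat hγ' (h Y SY hY hSY β y' γ' hy' hγ')
    (hrig Y hY y y' hy hy') (hnorm Y SY hY hSY y hy)

/-- **Cor. 6.10 (i), integral clause, direction "integrally temp-absolute ⇒ integrally absolute"**,
same inputs with the normaliser law for the canonical INTEGRAL structures.
[cite: MochizukiSemiAnbd2006, Cor 6.10(i) p.77] -/
theorem isIntegrallyAbsoluteCusp_of_isIntegrallyTempAbsoluteCusp {X : TemperedCurve p}
    (SX : CuspidalStructures X) {x : X.Pt} (hx : X.IsCusp x)
    (h66 : ∀ Y : TemperedCurve p, Ω.IsHyperbolicCurveOrigin Y → X.ProfiniteOuterIsoLifts Y)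
    (h65 : ∀ Y : TemperedCurve p, Ω.IsHyperbolicCurveOrigin Y → X.IsoPreservesCuspidalDecomp Y)
    (hrig : ∀ Y : TemperedCurve p, Ω.IsHyperbolicCurveOrigin Y → ∀ y y' : Y.Pt, Y.IsCusp y →
      Y.IsCusp y' → (∃ g : ConjAct Y.PiHat, Y.decompHat y' = g • Y.decompHat y) → y' = y)
    (hnormI : ∀ (Y : TemperedCurve p) (SY : CuspidalStructures Y), Ω.IsHyperbolicCurveOrigin Y →
      Ω.IsStructuresOrigin SY → ∀ y : Y.Pt, Y.IsCusp y → ∀ ε : ConjAct Y.PiHat,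
        ε • Y.decompHat y = Y.decompHat y →
          (fun S => ε • S) '' Y.hatOf (SY.canonicalIntegral y) = Y.hatOf (SY.canonicalIntegral y))
    (h : Ω.IsIntegrallyTempAbsoluteCusp SX x) : Ω.IsIntegrallyAbsoluteCusp SX x := by
  intro Y SY hY hSY αhat y γhat hy hDhat
  obtain ⟨⟨β, c, hc⟩, -⟩ := h66 Y hY αhat
  obtain ⟨y', hy', γ', hγ'⟩ := ((h65 Y hY) β (X.decomp x)).1 ⟨x, hx, 1, (one_smul _ _).symm⟩
  exact TemperedCurve.image_map_hatOf_eq_of_tempCompat αhat β c hc x (SX.canonicalIntegral x)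
    (fun z => SY.canonicalIntegral z) γhat γ' hDhat hγ' (h Y SY hY hSY β y' γ' hy' hγ')
    (hrig Y hY y y' hy hy') (hnormI Y SY hY hSY y hy)

/-! ### 3. The assembled reductions: Cor. 6.10 (i); F-1656; F-1655 -/

/-- **[SemiAnbd] Cor. 6.10 (i) as typed** (`AbsoluteIffTempAbsoluteCusp`) for a genuine `(X_K, SX)`,
FROM Thm. 6.6 (`TemperedOrigin.ProfiniteOuterIsoLiftsHolds`, F-1707), Thm. 6.5 (iii)
(`TemperedOrigin.CuspidalAbsolutenessHolds`, F-1704) and the three cusp-side interface laws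
(compactness of structure members, rigidity, normaliser — [Mzk8] §4 p. 33, Thm. 1.3 (ii)(iii)).
[cite: MochizukiSemiAnbd2006, Cor 6.10(i) p.77] -/
theorem absoluteIffTempAbsoluteCusp_of_laws
    (h66 : Ω.toTemperedOrigin.ProfiniteOuterIsoLiftsHolds)
    (h65 : Ω.toTemperedOrigin.CuspidalAbsolutenessHolds)
    (hcpt : ∀ (Y : TemperedCurve p) (SY : CuspidalStructures Y), Ω.IsHyperbolicCurveOrigin Y →
      Ω.IsStructuresOrigin SY → ∀ (y : Y.Pt), Y.IsCusp y →
        ∀ S ∈ SY.canonicalDiscrete y, IsCompact (S : Set Y.PiTemp))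
    (hrig : ∀ Y : TemperedCurve p, Ω.IsHyperbolicCurveOrigin Y → ∀ y y' : Y.Pt, Y.IsCusp y →
      Y.IsCusp y' → (∃ g : ConjAct Y.PiHat, Y.decompHat y' = g • Y.decompHat y) → y' = y)
    (hnorm : ∀ (Y : TemperedCurve p) (SY : CuspidalStructures Y), Ω.IsHyperbolicCurveOrigin Y →
      Ω.IsStructuresOrigin SY → ∀ y : Y.Pt, Y.IsCusp y → ∀ ε : ConjAct Y.PiHat,
        ε • Y.decompHat y = Y.decompHat y →
          (fun S => ε • S) '' Y.hatOf (SY.canonicalDiscrete y) = Y.hatOf (SY.canonicalDiscrete y))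
    (hnormI : ∀ (Y : TemperedCurve p) (SY : CuspidalStructures Y), Ω.IsHyperbolicCurveOrigin Y →
      Ω.IsStructuresOrigin SY → ∀ y : Y.Pt, Y.IsCusp y → ∀ ε : ConjAct Y.PiHat,
        ε • Y.decompHat y = Y.decompHat y →
          (fun S => ε • S) '' Y.hatOf (SY.canonicalIntegral y) = Y.hatOf (SY.canonicalIntegral y))
    {X : TemperedCurve p} (hX : Ω.IsHyperbolicCurveOrigin X) (SX : CuspidalStructures X)
    (hSX : Ω.IsStructuresOrigin SX) : Ω.AbsoluteIffTempAbsoluteCusp SX := by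
  intro x hx _hrat
  have hcX : ∀ S ∈ SX.canonicalDiscrete x, IsCompact (S : Set X.PiTemp) := hcpt X SX hX hSX x hx
  have h66X : ∀ Y : TemperedCurve p, Ω.IsHyperbolicCurveOrigin Y → X.ProfiniteOuterIsoLifts Y :=
    fun Y hY => h66 X Y hX hY
  have h65X : ∀ Y : TemperedCurve p, Ω.IsHyperbolicCurveOrigin Y → X.IsoPreservesCuspidalDecomp Y :=
    fun Y hY => h65 X Y hX hY
  exact ⟨⟨Ω.isDiscretelyTempAbsoluteCusp_of_isDiscretelyAbsoluteCusp SX x hcX hcpt,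
      Ω.isDiscretelyAbsoluteCusp_of_isDiscretelyTempAbsoluteCusp SX hx h66X h65X hrig hnorm⟩,
    fun _ => ⟨Ω.isIntegrallyTempAbsoluteCusp_of_isIntegrallyAbsoluteCusp SX x hcX hcpt,
      Ω.isIntegrallyAbsoluteCusp_of_isIntegrallyTempAbsoluteCusp SX hx h66X h65X hrig hnormI⟩⟩

/-- **F-1656 `TemperedAbsolutenessHolds Ω` ([SemiAnbd] Cor. 6.10 (i), (ii)) CONDITIONALLY**: from Thm. 6.6
(F-1707 `TemperedOrigin.ProfiniteOuterIsoLiftsHolds`), Thm. 6.5 (iii) (F-1704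
`TemperedOrigin.CuspidalAbsolutenessHolds`) and FOUR interface laws of the genuine [Mzk8] §4 data
(goodness/transport of `KummerTransport`; compactness of structure members; rigidity and normaliser of
the profinite cuspidal decomposition groups) — the printed "we thus conclude [cf. Theorem 6.6]" (p. 77)
with every input named.  The laws are hypotheses, never asserted. [cite: MochizukiSemiAnbd2006, Cor 6.10 p.77] -/
theorem temperedAbsolutenessHolds_of_laws
    (h66 : Ω.toTemperedOrigin.ProfiniteOuterIsoLiftsHolds)
    (h65 : Ω.toTemperedOrigin.CuspidalAbsolutenessHolds)
    (hgood : ∀ (X : TemperedCurve p) (kX : KummerUnitData X), Ω.IsHyperbolicCurveOrigin X →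
      Ω.IsKummerOrigin kX → ∀ (Y : TemperedCurve p) (kY : KummerUnitData Y) (t : KummerTransport kX kY),
      Ω.IsHyperbolicCurveOrigin Y → Ω.IsKummerOrigin kY → Ω.IsKummerTransportOrigin t →
      ∀ (αhat : X.PiHat ≃ₜ* Y.PiHat) (β : X.PiTemp ≃ₜ* Y.PiTemp), TemperedCurve.LiesUnder X Y αhat β →
        (kX.unitImage).map (t.h1OfHat αhat).toAddMonoidHom =
          (kX.unitImage).map (t.h1OfTemp β).toAddMonoidHom)
    (hcpt : ∀ (Y : TemperedCurve p) (SY : CuspidalStructures Y), Ω.IsHyperbolicCurveOrigin Y →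
      Ω.IsStructuresOrigin SY → ∀ (y : Y.Pt), Y.IsCusp y →
        ∀ S ∈ SY.canonicalDiscrete y, IsCompact (S : Set Y.PiTemp))
    (hrig : ∀ Y : TemperedCurve p, Ω.IsHyperbolicCurveOrigin Y → ∀ y y' : Y.Pt, Y.IsCusp y →
      Y.IsCusp y' → (∃ g : ConjAct Y.PiHat, Y.decompHat y' = g • Y.decompHat y) → y' = y)
    (hnorm : ∀ (Y : TemperedCurve p) (SY : CuspidalStructures Y), Ω.IsHyperbolicCurveOrigin Y →
      Ω.IsStructuresOrigin SY → ∀ y : Y.Pt, Y.IsCusp y → ∀ ε : ConjAct Y.PiHat,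
        ε • Y.decompHat y = Y.decompHat y →
          (fun S => ε • S) '' Y.hatOf (SY.canonicalDiscrete y) = Y.hatOf (SY.canonicalDiscrete y))
    (hnormI : ∀ (Y : TemperedCurve p) (SY : CuspidalStructures Y), Ω.IsHyperbolicCurveOrigin Y →
      Ω.IsStructuresOrigin SY → ∀ y : Y.Pt, Y.IsCusp y → ∀ ε : ConjAct Y.PiHat,
        ε • Y.decompHat y = Y.decompHat y →
          (fun S => ε • S) '' Y.hatOf (SY.canonicalIntegral y) = Y.hatOf (SY.canonicalIntegral y)) :
    Ω.TemperedAbsolutenessHolds := by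
  intro X SX kX hX hSX hkX
  exact ⟨Ω.absoluteIffTempAbsoluteCusp_of_laws h66 h65 hcpt hrig hnorm hnormI hX SX hSX,
    Ω.unitwiseAbsoluteIffTempAbsolute_of_profiniteOuterIsoLiftsHolds h66 hX kX (hgood X kX hX hkX)⟩

/-- **F-1655 `GenusZeroTempAbsolutenessHolds Ω` ([SemiAnbd] Cor. 6.11) CONDITIONALLY**: the printed proof
(p. 78 l. 1–2, "substituting the equivalences of Corollary 6.10, (i), (ii), into [Mzk8], Corollary 4.11")
composed with `temperedAbsolutenessHolds_of_laws`: from F-1707, F-1704, the four interface laws and the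
ABSOLUTE [Mzk8] Cor. 4.11 (hypothesis `hCor411`, not typed in the tree).
[cite: MochizukiSemiAnbd2006, Cor 6.11 pp.77-78] -/
theorem genusZeroTempAbsolutenessHolds_of_laws
    (h66 : Ω.toTemperedOrigin.ProfiniteOuterIsoLiftsHolds)
    (h65 : Ω.toTemperedOrigin.CuspidalAbsolutenessHolds)
    (hgood : ∀ (X : TemperedCurve p) (kX : KummerUnitData X), Ω.IsHyperbolicCurveOrigin X →
      Ω.IsKummerOrigin kX → ∀ (Y : TemperedCurve p) (kY : KummerUnitData Y) (t : KummerTransport kX kY),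
      Ω.IsHyperbolicCurveOrigin Y → Ω.IsKummerOrigin kY → Ω.IsKummerTransportOrigin t →
      ∀ (αhat : X.PiHat ≃ₜ* Y.PiHat) (β : X.PiTemp ≃ₜ* Y.PiTemp), TemperedCurve.LiesUnder X Y αhat β →
        (kX.unitImage).map (t.h1OfHat αhat).toAddMonoidHom =
          (kX.unitImage).map (t.h1OfTemp β).toAddMonoidHom)
    (hcpt : ∀ (Y : TemperedCurve p) (SY : CuspidalStructures Y), Ω.IsHyperbolicCurveOrigin Y →
      Ω.IsStructuresOrigin SY → ∀ (y : Y.Pt), Y.IsCusp y →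
        ∀ S ∈ SY.canonicalDiscrete y, IsCompact (S : Set Y.PiTemp))
    (hrig : ∀ Y : TemperedCurve p, Ω.IsHyperbolicCurveOrigin Y → ∀ y y' : Y.Pt, Y.IsCusp y →
      Y.IsCusp y' → (∃ g : ConjAct Y.PiHat, Y.decompHat y' = g • Y.decompHat y) → y' = y)
    (hnorm : ∀ (Y : TemperedCurve p) (SY : CuspidalStructures Y), Ω.IsHyperbolicCurveOrigin Y →
      Ω.IsStructuresOrigin SY → ∀ y : Y.Pt, Y.IsCusp y → ∀ ε : ConjAct Y.PiHat,
        ε • Y.decompHat y = Y.decompHat y →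
          (fun S => ε • S) '' Y.hatOf (SY.canonicalDiscrete y) = Y.hatOf (SY.canonicalDiscrete y))
    (hnormI : ∀ (Y : TemperedCurve p) (SY : CuspidalStructures Y), Ω.IsHyperbolicCurveOrigin Y →
      Ω.IsStructuresOrigin SY → ∀ y : Y.Pt, Y.IsCusp y → ∀ ε : ConjAct Y.PiHat,
        ε • Y.decompHat y = Y.decompHat y →
          (fun S => ε • S) '' Y.hatOf (SY.canonicalIntegral y) = Y.hatOf (SY.canonicalIntegral y))
    (hCor411 : ∀ (X : TemperedCurve p) (SX : CuspidalStructures X) (kX : KummerUnitData X)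
      (aX : TemperedCurve.CurveArithmeticFlags X), Ω.IsHyperbolicCurveOrigin X →
      Ω.IsStructuresOrigin SX → Ω.IsKummerOrigin kX → Ω.IsFlagsOrigin aX →
      SX.HasStableReduction → aX.IsIsogenousToGenusZero →
        Ω.IsUnitwiseAbsolute kX ∧
          ∀ x : X.Pt, X.IsCusp x → X.IsRationalPt x → Ω.IsIntegrallyAbsoluteCusp SX x) :
    Ω.GenusZeroTempAbsolutenessHolds :=
  Ω.genusZeroTempAbsolutenessHolds_of_temperedAbsolutenessHolds
    (Ω.temperedAbsolutenessHolds_of_laws h66 h65 hgood hcpt hrig hnorm hnormI) hCor411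

end AbsolutenessOrigin

end Literature.AnabelianGeometry.SemiGraphs

end
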